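import Summits.RiemannHypothesis.RiemannHypothesis.Theorems.UniversalFactorLehmerQuadrature

/-!
# RiemannHypothesis / UniversalFactor — certified quadrature along a horizontal segment

Route `RiemannHypothesis/UniversalFactor`, item `MediumKernelNoGo` (stmt-RiemannHypothesis-2577),
line `one-sided-average-sign-test`, stub `stub_quadH`.

`UniversalFactor.quadrature_error_le` bounds the error of an arbitrary quadrature rule applied to a
holomorphic function along a VERTICAL segment `x ↦ c + ix`.  The certificate for `MediumKernelNoGo`
integrates along HORIZONTAL segments `x ↦ c + x`; this file transports the bound by the rotation
`w ↦ c − i(w − c)`, which is an isometry of `ℂ` fixing `c` (so it preserves `ball c R₁` and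
`sphere c R`) and sends `c + ix` to `c + x`.

* `UniversalFactor.stub_quadH` — the horizontal-segment quadrature error bound.
-/

noncomputable section

set_option linter.dupNamespace false

namespace Summit.RiemannHypothesis.RiemannHypothesis.Theorems

open MeasureTheory Set Complex

/-- The rotation `w ↦ c − i(w − c)` is an isometry fixing `c`: `‖(c − i(w − c)) − c‖ = ‖w − c‖`. -/
theorem UniversalFactor.quadH_norm_rot (c w : ℂ) : ‖(c - I * (w - c)) - c‖ = ‖w - c‖ := by
  rw [sub_sub_cancel_left, norm_neg, norm_mul, Complex.norm_I, one_mul]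

/-- The rotation `w ↦ c − i(w − c)` sends the vertical direction to the horizontal one:
`c − i((c + x i) − c) = c + x`. -/
theorem UniversalFactor.quadH_rot_vertical (c z : ℂ) : c - I * ((c + z * I) - c) = c + z := by
  rw [add_sub_cancel_left]
  linear_combination (-z) * Complex.I_sq

/-- **Quadrature error for analytic functions along a horizontal segment.** Let `f` be holomorphic
on `ball c R₁`, `‖f z‖ ≤ M` for `z ∈ sphere c R` with `0 ≤ ρ < R < R₁`, let `u j ∈ [−ρ, ρ]` be nodes
and `W j` real weights (`j ∈ s`). Then for every `K : ℕ`,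
`‖∫_{−ρ}^{ρ} f(c + x) dx − Σ_j W_j f(c + u_j)‖ ≤
  M · (Σ_{n ≤ K} |∫_{−ρ}^{ρ} xⁿ − Σ_j W_j u_jⁿ| / Rⁿ + (2ρ + Σ_j |W_j|) · q^{K+1}/(1 − q))`, `q = ρ/R`.
Obtained from `UniversalFactor.quadrature_error_le` by the rotation `w ↦ c − i(w − c)`. -/
theorem UniversalFactor.stub_quadH :
    ∀ (f : ℂ → ℂ) (c : ℂ) (R R₁ ρ M : ℝ), 0 ≤ ρ → ρ < R → R < R₁ →
    DifferentiableOn ℂ f (Metric.ball c R₁) → (∀ z ∈ Metric.sphere c R, ‖f z‖ ≤ M) →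
    ∀ (s : Finset ℕ) (u W : ℕ → ℝ), (∀ j ∈ s, |u j| ≤ ρ) → ∀ K : ℕ,
      ‖(∫ x in (-ρ)..ρ, f (c + (x : ℂ))) - ∑ j ∈ s, (W j : ℂ) * f (c + (u j : ℂ))‖ ≤
        M * (∑ n ∈ Finset.range (K + 1),
              |((ρ ^ (n + 1) - (-ρ) ^ (n + 1)) / (n + 1) - ∑ j ∈ s, W j * u j ^ n)| / R ^ n
           + (2 * ρ + ∑ j ∈ s, |W j|) * ((ρ / R) ^ (K + 1) / (1 - ρ / R))) := by
  intro f c R R₁ ρ M hρ hρR hRR₁ hf hM s u W hu K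
  -- the rotated function `g w = f (c − i(w − c))`
  set g : ℂ → ℂ := fun w => f (c - I * (w - c)) with hg_def
  have hφ : Differentiable ℂ (fun w : ℂ => c - I * (w - c)) := by fun_prop
  have hmaps : Set.MapsTo (fun w : ℂ => c - I * (w - c)) (Metric.ball c R₁) (Metric.ball c R₁) := by
    intro w hw
    rw [Metric.mem_ball, dist_eq_norm] at hw ⊢
    rw [UniversalFactor.quadH_norm_rot]
    exact hw
  have hg : DifferentiableOn ℂ g (Metric.ball c R₁) := hf.comp hφ.differentiableOn hmaps
  have hgM : ∀ z ∈ Metric.sphere c R, ‖g z‖ ≤ M := by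
    intro z hz
    apply hM
    rw [Metric.mem_sphere, dist_eq_norm] at hz ⊢
    rw [UniversalFactor.quadH_norm_rot]
    exact hz
  -- `g` along the vertical segment is `f` along the horizontal one
  have hgx : ∀ z : ℂ, g (c + z * I) = f (c + z) := by
    intro z
    simp only [hg_def]
    rw [UniversalFactor.quadH_rot_vertical]
  have h := UniversalFactor.quadrature_error_le hρ hρR hRR₁ hg hgM s u W hu K
  simp only [hgx] at h
  exact h

end Summit.RiemannHypothesis.RiemannHypothesis.Theorems
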